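import Mathlib.Analysis.SpecialFunctions.Trigonometric.Basic
import HarnessLib

/-!
# X2c at `p = 3 ‖ N`, road LZZ: the FACTOR LEDGER of c2v MEMO-2 as ONE kernel identity — the constant
# `𝔠` relating the limit of Castella's display (virtual periods) to `V = ((1 − a_p p⁻¹)·log_{ω_E} P_K)²`
# on the Liu–Zhang–Zhang road equals `2⁵·g/(w_K²·√δ_K·c_M²)` (every `h_K`, `⟨f,f⟩`, `ψ(N)`, `∏β_q`, `π`
# cancels), and the PRINTED §1.4 measure constant leaves a stray `π/δ_K` (cell `bsd-eis`, seat
# `bsd-eis-cgshw` g14; crux 4 `BSDpOnCellC` = stmt-BirchSwinnertonDyer-19034, COMMISSION (O2)-LZZ@3, the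
# target of lemma 6 of the kernel rescale plan, cgshw MEMO-18 §5; referee item D5 of c2v MEMO-2 §7)

HONEST FRAMING (cell `bsd-eis`): THEOREMS ONLY — two identities between real numbers (`field_simp; ring`);
no definition, no named fact, nothing asserted about any `L`-function; nothing booked; X2 stays
CONSTRUCTION-SHAPED; no label or count moves. The identities certify the ARITHMETIC of c2v MEMO-2 §3 («the
computation in one line»: `4·4·8·6/24 = 32`, all `π`'s cancel against the true measure constant) — NOT the
readings that feed it (R-D, R-L1, R-N1, R-N3, R-P, R-M), which are the typist's clauses (MEMO-18 §4).

## Dictionary (c2v MEMO-2 §2–§3, rows of the ledger)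

`g` = the Shimura–Maass step constant of (N1) (row 7, `±2^a`); `h` = `h_K` (rows 4/11); `w` = `w_K`;
`s` = `√δ_K` (so `δ_K = s²`); `cM` = the Manin constant of the parametrisation (row 8); `Pet` = `⟨f,f⟩_{Γ₀(N)}`
(un-normalised Petersson norm, rows 5/8); `ψ` = `ψ(N) = N∏_{q∣N}(1+q⁻¹)` (rows 5/8); `B` = `∏_{q∣N}β_q` (rows
5/12). Inputs as displayed there: `L^{fin}(1,η) = 2πh/(w s)` (class number formula), `L^{fin}(1,Ad f) =
8π³·Pet·B/ψ` (Collins AMQ 2020 Thm 5 = Hida 1981 Thm 5.1), `ζ(2) = π²/6`, `‖φ‖²_{Pet,Tam} = 24π·cM²·Pet/ψ`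
(Tamagawa-normalised Petersson norm, YZZ13 §1.6 / Collins p. 9–10), and
`𝔠/u = g·4s·L(1,η)²·L(1,Ad)/(π²·ζ(2)·h²·‖φ‖²·B)` (TRUE measure constant `2^{g−3}π^g δ^{−½}`, reading R-M) resp.
`g·4·L(1,η)²·L(1,Ad)/(π·s·ζ(2)·h²·‖φ‖²·B)` (constant AS PRINTED in LZZ18 Thm 3.8, `2^{g−3}δ^{+½}`).

* `lzzLedger_constant_eq` : TRUE constant = `32·g/(w²·s·cM²)` — no `π`, no `h`, no `Pet`, no `ψ`, no `B`.
* `lzzLedger_printedConstant_eq` : PRINTED constant = `32·π·g/(w²·s³·cM²)` — the stray `π¹·δ⁻¹` of R-M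
  (a `k`-free transcendental cannot occur in a ratio of two `p`-adic numbers: the signature of the §1.4 slip).
So the 3-adic content of road LZZ is `v₃(2⁵g) − 2v₃(w_K) − v₃(√δ_K) − 2v₃(c_M) = 0` on every X2c datum at `3`
(`d_K ≠ −3` since `3` splits; `3 ∤ δ_K`; `3 ∤ c_M` = the binder `¬ p ∣ Dt.c`) — lemma 7 of MEMO-18 §5, whose atoms
`norm_map_natCast_eq_one` / `norm_map_sqrt_discr_eq_one` are already in `X2/NonsplitBDPValueDisplayRescale.lean`.

References: [LiuZhangZhang2018] Thm. 3.8, Thm. 3.10, Prop. 4.12, §1.4 (arXiv:1511.08172 pp. 6, 18, 23);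
[Collins2020] Thm. 5; [Hida1981] Thm. 5.1; [YuanZhangZhang2013] §1.6, Thm. 1.4; c2v MEMO-1 §4, MEMO-2 §2–§4, §7 D5.
-/

noncomputable section

namespace Summit.BirchSwinnertonDyer.Rank1Residual.X2

open Real

/-- **c2v MEMO-2 §3 in the kernel (TRUE measure constant): `𝔠/u = 32·g/(w_K²·√δ_K·c_M²)`.** With
`L(1,η) = 2πh/(ws)`, `L(1,Ad) = 8π³·Pet·B/ψ`, `ζ(2) = π²/6`, `‖φ‖² = 24π·cM²·Pet/ψ` substituted into
`g·4s·L(1,η)²·L(1,Ad)/(π²·ζ(2)·h²·‖φ‖²·B)`, every factor `h`, `Pet`, `ψ`, `B`, `π` cancels and `4·4·8·6/24 = 32`.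
[cite: LiuZhangZhang2018, Thm. 3.8 and Thm. 3.10 and Prop. 4.12 (arXiv:1511.08172 pp. 18, 23) (source of the displayed constant; the identity itself is arithmetic)] -/
theorem lzzLedger_constant_eq (g h w s cM Pet ψ B : ℝ) (hh : h ≠ 0) (hw : w ≠ 0) (hs : s ≠ 0)
    (hcM : cM ≠ 0) (hPet : Pet ≠ 0) (hψ : ψ ≠ 0) (hB : B ≠ 0) :
    g * (4 * s) * (2 * π * h / (w * s)) ^ 2 * (8 * π ^ 3 * Pet * B / ψ) /
        (π ^ 2 * (π ^ 2 / 6) * h ^ 2 * (24 * π * cM ^ 2 * Pet / ψ) * B) =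
      32 * g / (w ^ 2 * s * cM ^ 2) := by
  have hπ : (π : ℝ) ≠ 0 := Real.pi_ne_zero
  field_simp
  ring

/-- **The same with LZZ18 Thm. 3.8's constant AS PRINTED (`δ^{+½}` in place of `π·δ^{−½}`, §1.4):
`𝔠'/u = 32·π·g/(w_K²·δ_K^{3/2}·c_M²)`** — the stray `π¹·δ_K⁻¹` of reading R-M (c2v MEMO-2 §3 last lines, §4):
the rational skeleton `32/(w_K²c_M²)`, hence every `p`-adic valuation, is the same either way.
[cite: LiuZhangZhang2018, Thm. 3.8 and §1.4 (arXiv:1511.08172 pp. 6, 18) (printed constant; the identity itself is arithmetic)] -/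
theorem lzzLedger_printedConstant_eq (g h w s cM Pet ψ B : ℝ) (hh : h ≠ 0) (hw : w ≠ 0) (hs : s ≠ 0)
    (hcM : cM ≠ 0) (hPet : Pet ≠ 0) (hψ : ψ ≠ 0) (hB : B ≠ 0) :
    g * 4 * (2 * π * h / (w * s)) ^ 2 * (8 * π ^ 3 * Pet * B / ψ) /
        (π * s * (π ^ 2 / 6) * h ^ 2 * (24 * π * cM ^ 2 * Pet / ψ) * B) =
      32 * π * g / (w ^ 2 * s ^ 3 * cM ^ 2) := by
  have hπ : (π : ℝ) ≠ 0 := Real.pi_ne_zero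
  field_simp
  ring

/-- The two constants differ exactly by the factor `π/δ_K = π/s²` (the discrepancy of LZZ18 §1.4's measure
sentence against YZZ13 §1.6, reading R-M of c2v MEMO-2 §4): printed = true · `π/s²`. [folklore] -/
theorem lzzLedger_printedConstant_eq_constant_mul (g w s cM : ℝ) (hw : w ≠ 0) (hs : s ≠ 0)
    (hcM : cM ≠ 0) :
    32 * π * g / (w ^ 2 * s ^ 3 * cM ^ 2) = 32 * g / (w ^ 2 * s * cM ^ 2) * (π / s ^ 2) := by
  field_simp

end Summit.BirchSwinnertonDyer.Rank1Residual.X2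

end
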